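import Summits.QuantumFields.YangMills.Theorems.UnitScaleTiltProp7QTwSCentralTowerRows
import Summits.QuantumFields.YangMills.Theorems.UnitScaleTiltProp7TowerClosenessOfRegPr
import HarnessLib

/-!
# Route `UnitScaleTilt`, crux K1 «MinimiserStabilityRegPr» (stmt-QuantumFields-19200), route-R E′ (A′) «HCOW-VIA-Σ», row P-A2 «JOINT-Σ», file F3″-SUP (1∕2) —
# THE CHART-POINT SEAM: THE ROUTE'S `SU(2)` TOWER OF `U′ = e^{A₁}U₀` IS THE UNGUARDED `(M₂)ˣ` TOWER `emlIterU k U′♭` AT EVERY LEVEL `k ≤ K − n`, AND BOTH TOWERS ARE SPECIAL UNITARY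

Cell `ym3-torus`, width seat `ym-routeR-w4` (gen 14); offer «F3″-SEAM+SUP-T³» to the F3″ pen ★px22 g3 (LOCATE `LOCATE-PA2-F3-LEVELMASSES-px22g3.md` (V1) «the `emlIterU`∕`Averaging.iter`
seam») and the E′ namer ★p1 g17.  THE POINT.  F3″'s one-step inequality (★) (✓ `Prop7AccumulatedFrameStep`, B1) reads the PLAIN towers `emlIterU l W`, `emlIterU l U₀` (the unguarded
`(M₂)ˣ` average of ✓ `Prop8Chart`) and the accumulated frames `ν_l = frameAccU l U₀ W` ((97)), while the hol-ratio walk sum (✓ `Prop7HolRatioWalkSum`, B2b) and the single-bar level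
masses of (n3) (✓ `Prop7FibreLevelMassPerLevelT3.sum_normSq_levelRatio_le_LOnly_T3`) read the ROUTE's guarded `SU(2)` towers `Averaging.iter (blockAvg ℰp) l ·` (`ℰp = expMeanLogSU`, an
`abbrev`).  At the T³ member — `U₀ ∈ 𝔘_k(ε₀)` printed-regular, chart point `U′ = e^{A₁}U₀`, `‖A₁‖ < e·η`, windows `10¹²L³ε₀ ≤ 1`, `10⁹L²e ≤ 1` — the two must be IDENTIFIED for the
perturbed field `W = U′`.  For the background this is ✓ `Prop7SymAvgGLSmallOfRegPr.coe_iter_eq_emlIterU_of_regPr` (plaquette clause of `RegPr`); the chart point is NOT plaquette-small at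
the threshold `a₀ = ε₀η²` (its plaquettes move by `~eη ≫ ε₀η²`), so that theorem does not apply to it.  Here instead:

* §1 (generic `𝔸`) (97) read forwards: `Ū^{(k)} = (V^{(k)})^{ν_k}` (`emlIterU_eq_gaugeActT_frameAccU_dbarCovIterU`; bondwise `emlIterU_apply_eq_frame_mul_dbarCovIterU_mul`), hence the
  (0.4) loop variables of the plain tower are the `ν_k(ĉ)`-conjugates of the covariant tower's (`loopHolU_emlIterU_eq_conj`, ✓ `Prop8ChartCovariance.loopHolU_gaugeActT`).
* §2 `norm_loopHolU_dbarCovIterU_sub_one_le_of_regPr` — the per-`e` body of ✓ `towerRows_of_regPr`: the covariant tower's loops are within `1∕8` of `1` at every `j < K − n`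
  (✓ `norm_dbarCovIterU_rel_sub_one_le_of_regPr` + ✓ `loopHolU_emlIterU_bgUnits_le_sixteenth_of_regPr`); ★★★ **`coe_iter_chart_eq_emlIterU_of_regPr`** — THE SEAM:
  `∀ k ≤ K − n, (Averaging.iter (blockAvg ℰp) k U′)♭ = emlIterU k U′♭`, by strong induction on the guard (✓ `Prop7SymAvgGL.unitsField_toUField_iter_of_small`): the loops of `emlIterU s U′♭`
  are conjugates by the special-unitary `ν_s(ĉ)` (✓ `frameAccU_bgUnits_mem_specialUnitaryGroup_of_regPr`) of loops within `1∕8 < δ_{SU(2)} = 1∕3`.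
* §3 ★★ `emlIterU_chart_mem_specialUnitaryGroup_of_regPr` ∕ ★★ `dbarCovIterU_chart_mem_specialUnitaryGroup_of_regPr` — the plain tower of `U′♭` AND the covariant double-bar tower
  `V^{(k)} = dbarCovIterU k U₀♭ U′♭` are `SU(2)`- (hence `U1`-) valued at EVERY `k ≤ K − n` (the all-levels readings of ✓ `dbarCovIterU_emlIterU_mem_specialUnitaryGroup_of_plaqSmall`;
  the top level was ✓ `dbarTwS_mem_specialUnitaryUnits_of_regPr`) — B2b's `(1+δ)^{|st|}` telescoping wants both plain towers unitary.
Sibling file (2∕2) `…AccumulatedFrameSupT3`: the frame sup at every level, the single-bar ratio sups, (★) at the member.  THEOREMS ONLY (0 `def`, 0 `sorry`), compositions of landed letters;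
`--supports stmt-QuantumFields-19200 --as helper`, count-neutral.  Nothing of F3″-B2c∕C, P-A2, `hcoW`, E′, EX or the crux is claimed; YM₃ on T³ is a ladder rung (R3), not d = 4, not
infinite volume, not a mass gap, not the Clay problem.

References: T. Bałaban, CMP **98** (1985) 17–51 [Balaban1985Averaging] ((8)–(9), (11)–(12) pp.18–19, (19) p.21, (89)–(92) p.31, (97) p.32, (127) p.37, (161)–(163) p.42, p.44);
CMP **109** (1987) 249–301 [Balaban1987RG1] ((0.4), (0.11) p.253); CMP **102** (1985) 277–309 [Balaban1985Variational] ((2) p.278, (44) p.285, (146) p.301).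
-/

set_option autoImplicit false

noncomputable section

open scoped Matrix.Norms.L2Operator BigOperators

namespace Summit.QuantumFields.YangMills.Theorems.Prop7ChartPointTowerSeam

open NormedSpace
open Literature.MathematicalPhysics.QuantumFieldTheory.Balaban1983to89
open T3ContinuumYM3Torus
open T4Continuum BlockAveraging ExpMeanLog
open B10Eq27TorusAxialLog (holT gaugeActT gaugeActT_apply transl unitsField toUField suIncl val_suIncl)
open B7Prop1Explicit (expUnit val_expUnit U1 mem_U1 disp norm_units_conj_sub_one_le norm_inv_sub_one_le)
open B7Prop2SpecialUnitary (specialUnitaryUnits mem_specialUnitaryUnits specialUnitaryUnits_le_U1)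
open T3RegularMinimiser (regThreshold)
open T3PrintedRegularMinimiser (RegPr)
open T3SectALandauChart (eta eta_pos bgUnits)
open Summit.QuantumFields.YangMills.Theorems.Prop8Chart (loopHolU emlIterU coe_unitsField_toUField coe_loopHolU_unitsField loopHolU_gaugeActT)
open Summit.QuantumFields.YangMills.Theorems.Prop7SymAvgGL (iterGL unitsField_toUField_iter_of_small iterGL_eq_emlIterU)
open Summit.QuantumFields.YangMills.Theorems.Prop7SymAvgGLSmallOfRegPr (coe_iter_eq_emlIterU_of_regPr bgUnits_eq)
open Summit.QuantumFields.YangMills.Theorems.Prop7SymAvgTwSym (dbarCovIterU frameAccU dbarCovIterU_eq_gaugeActT_frameAccU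
  norm_sub_le_of_rel norm_inv_sub_inv_le_of_rel norm_loopHolU_sub_one_le_of_rel emlIterU_bgUnits_mem_U1_of_regPr
  loopHolU_emlIterU_bgUnits_le_sixteenth_of_regPr norm_dbarCovIterU_rel_sub_one_le_of_regPr)
open Summit.QuantumFields.YangMills.Theorems.Prop7TowerClosenessOfRegPr (bgUnits_eq_expUnit_mul window7_of_window12 frameAccU_bgUnits_mem_specialUnitaryGroup_of_regPr)
open Summit.QuantumFields.YangMills.Theorems.Prop7SymFrameBound (su2_pred_closure)
open Summit.QuantumFields.YangMills.Theorems.AvgActionDefect (deltaSU_fin_two)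

/-! ## §1 Generic: the plain tower in the accumulated frames ((97) read forwards) -/

section Generic

variable {P : Params} {𝔸 : Type*} [NormedRing 𝔸] [NormedAlgebra ℂ 𝔸] [CompleteSpace 𝔸]

/-- (97) read forwards: the PLAIN `k`-fold average of the full field is the covariant double-bar tower gauged by the accumulated frames,
`Ū^{(k)} = (V^{(k)})^{v_k}`. [cite: Balaban1985Averaging, (97) p.32, (8) p.19] -/
theorem emlIterU_eq_gaugeActT_frameAccU_dbarCovIterU (k : ℕ) (U₀ W : GaugeField P 0 𝔸ˣ) :
    emlIterU k W = gaugeActT (frameAccU k U₀ W) (dbarCovIterU k U₀ W) := by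
  rw [dbarCovIterU_eq_gaugeActT_frameAccU U₀ W k]
  funext b
  rw [gaugeActT_apply, gaugeActT_apply]
  group

/-- (97) bondwise: `Ū^{(k)}(b) = v_k(b₋)·V^{(k)}(b)·v_k(b₊)⁻¹`. [cite: Balaban1985Averaging, (97) p.32, (8) p.19] -/
theorem emlIterU_apply_eq_frame_mul_dbarCovIterU_mul (k : ℕ) (U₀ W : GaugeField P 0 𝔸ˣ) (b : PBond P k) :
    emlIterU k W b = frameAccU k U₀ W b.src * dbarCovIterU k U₀ W b * (frameAccU k U₀ W b.tgt)⁻¹ := by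
  rw [emlIterU_eq_gaugeActT_frameAccU_dbarCovIterU k U₀ W, gaugeActT_apply]

/-- (97) on the (0.4) loop variables: the loops of the plain tower are the `v_k(ĉ)`-conjugates of the loops of the covariant tower.
[cite: Balaban1985Averaging, (97) p.32; Balaban1987RG1, (0.4) p.253] -/
theorem loopHolU_emlIterU_eq_conj (k : ℕ) (U₀ W : GaugeField P 0 𝔸ˣ) (c : PBond P (k + 1)) (i : Idx P) :
    loopHolU (emlIterU k W) c i = frameAccU k U₀ W (emb c.src) * loopHolU (dbarCovIterU k U₀ W) c i * (frameAccU k U₀ W (emb c.src))⁻¹ := by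
  rw [emlIterU_eq_gaugeActT_frameAccU_dbarCovIterU k U₀ W, loopHolU_gaugeActT]

end Generic

/-! ## §2 The T³ member: the chart point's ROUTE tower is the unguarded `(M₂)ˣ` tower -/

section T3

variable (F : T3Family) {n K : ℕ}

/-- **THE (0.4) LOOP VARIABLES OF THE PERTURBED COVARIANT TOWER ARE WITHIN `1∕8` OF `1`, LEVEL BY LEVEL** — the per-`e` body of ✓`towerRows_of_regPr`: at `U₀ ∈ 𝔘_k(ε₀)`
(`10¹²L³ε₀ ≤ 1`), `‖A(b)‖ ≤ e·η` (`10⁹L²e ≤ 1`), every `j < K − n`: `‖V^{(j)}(loop_i(c)) − 1‖ ≤ 1∕8` for `V^{(j)} = dbarCovIterU j U₀♭ (e^{A}U₀♭)` (the tower is bondwise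
`6(2e + 2700Lε₀)`-close to the `U1`-valued background tower ✓`norm_dbarCovIterU_rel_sub_one_le_of_regPr`, whose loops are within `1∕16` ✓`loopHolU_emlIterU_bgUnits_le_sixteenth_of_regPr`;
`2ℓ·12(2e + 2700Lε₀) ≤ 1∕16`). [cite: Balaban1985Averaging, (89)-(92) p.31, (161)-(163) p.42; Balaban1987RG1, (0.4) p.253; Balaban1985Variational, (2) p.278] -/
theorem norm_loopHolU_dbarCovIterU_sub_one_le_of_regPr {ε₀ e : ℝ} (hε₀ : 0 < ε₀) (he : 0 < e) (hWe : 10 ^ 9 * (F.L : ℝ) ^ 2 * e ≤ 1)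
    (hWε : 10 ^ 12 * (F.L : ℝ) ^ 3 * ε₀ ≤ 1)
    (U₀ : GaugeField (F.P K) 0 (Matrix.specialUnitaryGroup (Fin 2) ℂ)) (hreg : RegPr F n K ε₀ U₀)
    (A : PBond (F.P K) 0 → Matrix (Fin 2) (Fin 2) ℂ) (hA : ∀ b, ‖A b‖ ≤ e * eta F n K) {j : ℕ} (hj : j < K - n)
    (c : PBond (F.P K) (j + 1)) (i : Idx (F.P K)) :
    ‖((loopHolU (dbarCovIterU j (bgUnits F K U₀) (fun b => expUnit (A b) * bgUnits F K U₀ b)) c i : (Matrix (Fin 2) (Fin 2) ℂ)ˣ) : Matrix (Fin 2) (Fin 2) ℂ) - 1‖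
      ≤ 1 / 8 := by
  have hd : (F.P K).d = 3 := T3Family.P_d F K
  have hLL : ((F.P K).L : ℝ) = F.L := rfl
  have hL3 : 3 ≤ F.L := by obtain ⟨a, ha⟩ := F.hL.1; have := F.hL.2; omega
  have hL1 : (1 : ℝ) ≤ F.L := by exact_mod_cast (show 1 ≤ F.L by omega)
  have hε7 : 10 ^ 7 * (F.L : ℝ) ^ 3 * ε₀ ≤ 1 := window7_of_window12 F hε₀ hWε
  have hℓ : ((((F.P K).d + 2) * (F.P K).L : ℕ) : ℝ) = 5 * (F.L : ℝ) := by
    rw [hd, ← hLL]; push_cast; ring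
  -- numerics: `r := 3(2e + 2700Lε₀) ≤ ½`, `2ℓ(2r) ≤ 1∕16`
  set r : ℝ := 3 * (2 * e + 2700 * (F.L : ℝ) * ε₀) with hr
  have hr0 : 0 ≤ r := by positivity
  have he9 : 10 ^ 9 * ((F.L : ℝ) * e) ≤ 1 := by
    have hL12 : (F.L : ℝ) ≤ (F.L : ℝ) ^ 2 := by nlinarith
    have : (F.L : ℝ) * e ≤ (F.L : ℝ) ^ 2 * e := mul_le_mul_of_nonneg_right hL12 he.le
    nlinarith
  have hLε : 10 ^ 12 * ((F.L : ℝ) ^ 2 * ε₀) ≤ 1 := by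
    have : (F.L : ℝ) ^ 2 * ε₀ ≤ (F.L : ℝ) ^ 3 * ε₀ := mul_le_mul_of_nonneg_right (pow_le_pow_right₀ hL1 (by norm_num : 2 ≤ 3)) hε₀.le
    linarith
  have hnum : 2 * ((((F.P K).d + 2) * (F.P K).L : ℕ) : ℝ) * (2 * r) ≤ 1 / 16 := by
    rw [hℓ, hr]
    have e1 : 2 * (5 * (F.L : ℝ)) * (2 * (3 * (2 * e + 2700 * (F.L : ℝ) * ε₀))) = 120 * ((F.L : ℝ) * e) + 162000 * ((F.L : ℝ) ^ 2 * ε₀) := by ring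
    rw [e1]; nlinarith
  have hr2 : r ≤ 1 / 2 := by
    have hℓ1 : (1 : ℝ) ≤ 2 * ((((F.P K).d + 2) * (F.P K).L : ℕ) : ℝ) := by rw [hℓ]; linarith
    nlinarith
  -- the background tower is `U1`-valued, the perturbed tower `r`-close to it relatively
  have hV : ∀ b : PBond (F.P K) j, emlIterU j (bgUnits F K U₀) b ∈ U1 (Matrix (Fin 2) (Fin 2) ℂ) :=
    fun b => emlIterU_bgUnits_mem_U1_of_regPr F hε₀ hε7 hreg hj.le b
  have hrel : ∀ b : PBond (F.P K) j,
      ‖((dbarCovIterU j (bgUnits F K U₀) (fun b => expUnit (A b) * bgUnits F K U₀ b) b : (Matrix (Fin 2) (Fin 2) ℂ)ˣ) : Matrix (Fin 2) (Fin 2) ℂ) *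
          (((emlIterU j (bgUnits F K U₀) b)⁻¹ : (Matrix (Fin 2) (Fin 2) ℂ)ˣ) : Matrix (Fin 2) (Fin 2) ℂ) - 1‖ ≤ r :=
    fun b => norm_dbarCovIterU_rel_sub_one_le_of_regPr F hε₀ he.le hWe hWε U₀ hreg A hA hj.le b
  have h₁ : ∀ b : PBond (F.P K) j,
      ‖((dbarCovIterU j (bgUnits F K U₀) (fun b => expUnit (A b) * bgUnits F K U₀ b) b : (Matrix (Fin 2) (Fin 2) ℂ)ˣ) : Matrix (Fin 2) (Fin 2) ℂ) -
          ((emlIterU j (bgUnits F K U₀) b : (Matrix (Fin 2) (Fin 2) ℂ)ˣ) : Matrix (Fin 2) (Fin 2) ℂ)‖ ≤ 2 * r :=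
    fun b => (norm_sub_le_of_rel (hV b) (hrel b)).trans (by linarith)
  have h₂ : ∀ b : PBond (F.P K) j,
      ‖(((dbarCovIterU j (bgUnits F K U₀) (fun b => expUnit (A b) * bgUnits F K U₀ b) b)⁻¹ : (Matrix (Fin 2) (Fin 2) ℂ)ˣ) : Matrix (Fin 2) (Fin 2) ℂ) -
          (((emlIterU j (bgUnits F K U₀) b)⁻¹ : (Matrix (Fin 2) (Fin 2) ℂ)ˣ) : Matrix (Fin 2) (Fin 2) ℂ)‖ ≤ 2 * r :=
    fun b => norm_inv_sub_inv_le_of_rel (hV b) hr2 (hrel b)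
  have hδ0 : 0 ≤ 2 * r := by positivity
  have hℓδ : 2 * ((((F.P K).d + 2) * (F.P K).L : ℕ) : ℝ) * (2 * r) ≤ 1 := hnum.trans (by norm_num)
  have h1 := norm_loopHolU_sub_one_le_of_rel _ _ hδ0 hV h₁ h₂ hℓδ c i
  have h2 := loopHolU_emlIterU_bgUnits_le_sixteenth_of_regPr F hε₀ hε7 hreg j hj c i
  linarith

/-- ★★★ **THE SEAM FOR THE PERTURBED FIELD: THE ROUTE'S `SU(2)` TOWER OF THE CHART POINT IS THE UNGUARDED `(M₂)ˣ` TOWER, AT EVERY LEVEL `k ≤ K − n`** — for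
`U₀ ∈ 𝔘_k(ε₀)` (`10¹²L³ε₀ ≤ 1`) and the chart point `U′ = e^{A₁}U₀` (`‖A₁‖ < e·η`, `10⁹L²e ≤ 1`): `(Ū′^{(k)})♭ = emlIterU k U′♭` with `Ū′^{(k)} = Averaging.iter (blockAvg ℰp) k U′`
the ROUTE's guarded average (`ℰp = expMeanLogSU`).  The field `U′` is NOT plaquette-small at the threshold `a₀ = ε₀η²` (so ✓`coe_iter_eq_emlIterU_of_regPr` does not apply); instead
the guards of every step are inactive because, by (97), the plain tower of `U′♭` is the covariant double-bar tower gauged by the special-unitary accumulated frames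
(✓`frameAccU_bgUnits_mem_specialUnitaryGroup_of_regPr`), whose (0.4) loops are within `1∕8 < δ_{SU(2)} = 1∕3` of `1` (`norm_loopHolU_dbarCovIterU_sub_one_le_of_regPr`);
strong induction on the level with ✓`unitsField_toUField_iter_of_small`. [cite: Balaban1987RG1, (0.4)+(0.11) p.253; Balaban1985Averaging, (97) p.32; Balaban1985Variational, (2) p.278, (44) p.285] -/
theorem coe_iter_chart_eq_emlIterU_of_regPr {ε₀ e : ℝ} (hε₀ : 0 < ε₀) (he : 0 < e) (hWe : 10 ^ 9 * (F.L : ℝ) ^ 2 * e ≤ 1)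
    (hWε : 10 ^ 12 * (F.L : ℝ) ^ 3 * ε₀ ≤ 1)
    (U₀ U' : GaugeField (F.P K) 0 (Matrix.specialUnitaryGroup (Fin 2) ℂ)) (hreg : RegPr F n K ε₀ U₀)
    (A₁ : PBond (F.P K) 0 → Matrix (Fin 2) (Fin 2) ℂ) (hA₁ : ‖A₁‖ < e * eta F n K)
    (hU' : ∀ b, ((U' b : Matrix.specialUnitaryGroup (Fin 2) ℂ) : Matrix (Fin 2) (Fin 2) ℂ) = exp (A₁ b) * ((U₀ b : Matrix.specialUnitaryGroup (Fin 2) ℂ) : Matrix (Fin 2) (Fin 2) ℂ)) :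
    ∀ k, k ≤ K - n →
      unitsField (toUField (Averaging.iter (fun l => blockAvg (P := F.P K) (j := l) T3UnitLawDensityEML.ℰp) k U')) = emlIterU k (bgUnits F K U') := by
  have hA₁b : ∀ b, ‖A₁ b‖ ≤ e * eta F n K := fun b => (norm_le_pi_norm A₁ b).trans hA₁.le
  have hcfg := bgUnits_eq_expUnit_mul F U₀ U' A₁ hU'
  -- the loop guards at every level `s < k`, by induction on `k`
  have hsmall : ∀ k, k ≤ K - n → ∀ s, s < k → ∀ (c : PBond (F.P K) (s + 1)) (i : Idx (F.P K)),
      ‖((loopHol (Averaging.iter (fun l => blockAvg (P := F.P K) (j := l) T3UnitLawDensityEML.ℰp) s U') c i : Matrix.specialUnitaryGroup (Fin 2) ℂ) :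
          Matrix (Fin 2) (Fin 2) ℂ) - 1‖ < deltaSU (Fin 2) := by
    intro k
    induction k with
    | zero => intro _ s hs; exact absurd hs (Nat.not_lt_zero s)
    | succ k ih =>
      intro hk s hs c i
      have hk' : k ≤ K - n := (Nat.le_succ k).trans hk
      rcases Nat.lt_succ_iff_lt_or_eq.1 hs with hs' | rfl
      · exact ih hk' s hs' c i
      · have hkK : s < K - n := hk
        have hid := unitsField_toUField_iter_of_small U' s (ih hk')
        have e1 : ((loopHol (Averaging.iter (fun l => blockAvg (P := F.P K) (j := l) T3UnitLawDensityEML.ℰp) s U') c i : Matrix.specialUnitaryGroup (Fin 2) ℂ) :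
              Matrix (Fin 2) (Fin 2) ℂ)
            = ((loopHolU (emlIterU s (bgUnits F K U')) c i : (Matrix (Fin 2) (Fin 2) ℂ)ˣ) : Matrix (Fin 2) (Fin 2) ℂ) := by
          rw [← coe_loopHolU_unitsField, hid, iterGL_eq_emlIterU]; rfl
        rw [e1, loopHolU_emlIterU_eq_conj s (bgUnits F K U₀) (bgUnits F K U') c i, Units.val_mul, Units.val_mul]
        have hν : frameAccU s (bgUnits F K U₀) (bgUnits F K U') (emb c.src) ∈ U1 (Matrix (Fin 2) (Fin 2) ℂ) :=
          specialUnitaryUnits_le_U1 (by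
            rw [mem_specialUnitaryUnits]
            exact frameAccU_bgUnits_mem_specialUnitaryGroup_of_regPr F hε₀ he hWe hWε U₀ U' hreg A₁ hA₁ hU' hk' _)
        have hloop := norm_loopHolU_dbarCovIterU_sub_one_le_of_regPr F hε₀ he hWe hWε U₀ hreg A₁ hA₁b hkK c i
        rw [← hcfg] at hloop
        calc _ ≤ ‖((loopHolU (dbarCovIterU s (bgUnits F K U₀) (bgUnits F K U')) c i : (Matrix (Fin 2) (Fin 2) ℂ)ˣ) : Matrix (Fin 2) (Fin 2) ℂ) - 1‖ :=
              norm_units_conj_sub_one_le hν _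
          _ ≤ 1 / 8 := hloop
          _ < deltaSU (Fin 2) := by rw [deltaSU_fin_two]; norm_num
  intro k hk
  rw [unitsField_toUField_iter_of_small U' k (hsmall k hk), iterGL_eq_emlIterU]
  rfl

/-! ## §3 Both towers are special unitary at every level `k ≤ K − n` -/

/-- ★★ **THE PLAIN TOWER OF THE CHART POINT IS SPECIAL UNITARY AT EVERY LEVEL `k ≤ K − n`**: `Ū^{(k)}[U′♭](b) ∈ SU(2)` — it IS the route's `SU(2)` tower read in `(M₂)ˣ`
(`coe_iter_chart_eq_emlIterU_of_regPr`). [cite: Balaban1987RG1, (0.11) p.253; Balaban1985Averaging, (19) p.21; Balaban1985Variational, (44) p.285] -/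
theorem emlIterU_chart_mem_specialUnitaryGroup_of_regPr {ε₀ e : ℝ} (hε₀ : 0 < ε₀) (he : 0 < e) (hWe : 10 ^ 9 * (F.L : ℝ) ^ 2 * e ≤ 1)
    (hWε : 10 ^ 12 * (F.L : ℝ) ^ 3 * ε₀ ≤ 1)
    (U₀ U' : GaugeField (F.P K) 0 (Matrix.specialUnitaryGroup (Fin 2) ℂ)) (hreg : RegPr F n K ε₀ U₀)
    (A₁ : PBond (F.P K) 0 → Matrix (Fin 2) (Fin 2) ℂ) (hA₁ : ‖A₁‖ < e * eta F n K)
    (hU' : ∀ b, ((U' b : Matrix.specialUnitaryGroup (Fin 2) ℂ) : Matrix (Fin 2) (Fin 2) ℂ) = exp (A₁ b) * ((U₀ b : Matrix.specialUnitaryGroup (Fin 2) ℂ) : Matrix (Fin 2) (Fin 2) ℂ))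
    {k : ℕ} (hk : k ≤ K - n) (b : PBond (F.P K) k) :
    ((emlIterU k (bgUnits F K U') b : (Matrix (Fin 2) (Fin 2) ℂ)ˣ) : Matrix (Fin 2) (Fin 2) ℂ) ∈ Matrix.specialUnitaryGroup (Fin 2) ℂ ∧
      emlIterU k (bgUnits F K U') b ∈ U1 (Matrix (Fin 2) (Fin 2) ℂ) := by
  have hsu : ((emlIterU k (bgUnits F K U') b : (Matrix (Fin 2) (Fin 2) ℂ)ˣ) : Matrix (Fin 2) (Fin 2) ℂ) ∈ Matrix.specialUnitaryGroup (Fin 2) ℂ := by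
    rw [← coe_iter_chart_eq_emlIterU_of_regPr F hε₀ he hWe hWε U₀ U' hreg A₁ hA₁ hU' k hk, coe_unitsField_toUField]
    exact (Averaging.iter (fun l => blockAvg (P := F.P K) (j := l) T3UnitLawDensityEML.ℰp) k U' b).2
  exact ⟨hsu, specialUnitaryUnits_le_U1 (by rw [mem_specialUnitaryUnits]; exact hsu)⟩

/-- ★★ **THE COVARIANT DOUBLE-BAR TOWER IS SPECIAL UNITARY AT EVERY LEVEL `k ≤ K − n`**: `V^{(k)}(b) = dbarCovIterU k U₀♭ U′♭ b ∈ SU(2)` — by (97)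
`V^{(k)}(b) = ν_k(b₋)⁻¹·Ū′^{(k)}(b)·ν_k(b₊)` with the plain tower and the accumulated frames special unitary (the all-levels T³ reading of
✓`dbarCovIterU_emlIterU_mem_specialUnitaryGroup_of_plaqSmall`; the top level is ✓`dbarTwS_mem_specialUnitaryUnits_of_regPr`). [cite: Balaban1985Averaging, (97) p.32, (127) p.37; Balaban1985Variational, (44) p.285] -/
theorem dbarCovIterU_chart_mem_specialUnitaryGroup_of_regPr {ε₀ e : ℝ} (hε₀ : 0 < ε₀) (he : 0 < e) (hWe : 10 ^ 9 * (F.L : ℝ) ^ 2 * e ≤ 1)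
    (hWε : 10 ^ 12 * (F.L : ℝ) ^ 3 * ε₀ ≤ 1)
    (U₀ U' : GaugeField (F.P K) 0 (Matrix.specialUnitaryGroup (Fin 2) ℂ)) (hreg : RegPr F n K ε₀ U₀)
    (A₁ : PBond (F.P K) 0 → Matrix (Fin 2) (Fin 2) ℂ) (hA₁ : ‖A₁‖ < e * eta F n K)
    (hU' : ∀ b, ((U' b : Matrix.specialUnitaryGroup (Fin 2) ℂ) : Matrix (Fin 2) (Fin 2) ℂ) = exp (A₁ b) * ((U₀ b : Matrix.specialUnitaryGroup (Fin 2) ℂ) : Matrix (Fin 2) (Fin 2) ℂ))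
    {k : ℕ} (hk : k ≤ K - n) (b : PBond (F.P K) k) :
    ((dbarCovIterU k (bgUnits F K U₀) (bgUnits F K U') b : (Matrix (Fin 2) (Fin 2) ℂ)ˣ) : Matrix (Fin 2) (Fin 2) ℂ) ∈ Matrix.specialUnitaryGroup (Fin 2) ℂ ∧
      dbarCovIterU k (bgUnits F K U₀) (bgUnits F K U') b ∈ U1 (Matrix (Fin 2) (Fin 2) ℂ) := by
  obtain ⟨-, hmul, hinv, -⟩ := su2_pred_closure (P := F.P K)
  have hν := fun x => frameAccU_bgUnits_mem_specialUnitaryGroup_of_regPr F hε₀ he hWe hWε U₀ U' hreg A₁ hA₁ hU' hk x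
  have hU := (emlIterU_chart_mem_specialUnitaryGroup_of_regPr F hε₀ he hWe hWε U₀ U' hreg A₁ hA₁ hU' hk b).1
  have e1 : dbarCovIterU k (bgUnits F K U₀) (bgUnits F K U') b
      = (frameAccU k (bgUnits F K U₀) (bgUnits F K U') b.src)⁻¹ * emlIterU k (bgUnits F K U') b * frameAccU k (bgUnits F K U₀) (bgUnits F K U') b.tgt := by
    rw [dbarCovIterU_eq_gaugeActT_frameAccU (bgUnits F K U₀) (bgUnits F K U') k, gaugeActT_apply, inv_inv]
  have hsu : ((dbarCovIterU k (bgUnits F K U₀) (bgUnits F K U') b : (Matrix (Fin 2) (Fin 2) ℂ)ˣ) : Matrix (Fin 2) (Fin 2) ℂ) ∈ Matrix.specialUnitaryGroup (Fin 2) ℂ := by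
    rw [e1, Units.val_mul, Units.val_mul]
    exact hmul _ _ (hmul _ _ (hinv _ (hν b.src)) hU) (hν b.tgt)
  exact ⟨hsu, specialUnitaryUnits_le_U1 (by rw [mem_specialUnitaryUnits]; exact hsu)⟩

end T3

end Summit.QuantumFields.YangMills.Theorems.Prop7ChartPointTowerSeam

end
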